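import Summits.BirchSwinnertonDyer.BirchSwinnertonDyer.Theses.ResidualThetaTransportAtTwo
import Summits.BirchSwinnertonDyer.BirchSwinnertonDyer.Theorems.ResidualThetaTransportAtTwoSignedMuSeedAtTwoPlusPlusLocalMuRoad
import Summits.BirchSwinnertonDyer.BirchSwinnertonDyer.Theorems.ResidualThetaTransportAtTwoSignedMuVanishingAtTwoPlusLineV49
import Summits.BirchSwinnertonDyer.BirchSwinnertonDyer.Theorems.ResidualThetaTransportAtTwoSignedMuVanishingAtTwoPlusNeronMuChild
import Literature.NumberTheory.EllipticCurves.TateModuleContinuityProofs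
import Literature.NumberTheory.EllipticCurves.TateModuleFreeProofs
import HarnessLib

/-!
# Crux Kμ⁺ `SignedMuVanishingAtTwoPlus` (stmt-BirchSwinnertonDyer-20689) / seed `SignedMuSeedAtTwoPlus` (stmt-21438),
# lines `kolyvagin_char_two` / `pt_trivial_half`: the μ-ROAD keyed to the route — the seed (`A := W`), the algebraic
# conjunct and the crux BY NAME from {(F) on the habitat⁺, a `2`-adic Coleman–Poitou–Tate μ-PACKAGE, analytic supply,
# FLAT (= item 21437, or Abbes–Ullmo Thm. A)} — with NO plus-local stub S1 and NO split

Cell `bsd-wall`, width seat `bsd-wall-rtt-p4-w2` g8. THEOREMS ONLY (no `def`, no named fact, no `sorry`); `--supports` the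
crux; nothing about any curve is asserted and BSD is NOT proved by any of this. Companion of the route-independent core
`…SignedMuSeedAtTwoPlusPlusLocalMuRoad` (step (Z4) of the pt-trivial-half decomposition of S1, this seat): there the module
algebra «cover `ker k ≤ range j` + one killed generator `ξ` with `2 ∤ ξ` + (F) ⇒ `X⁺` torsion, `μ⁺ = 0`» is proved for any
number field / prime / sign and restated at `p = 2` in the binder shape of route TP2's (7.20)-package. HERE it is keyed to
the habitat⁺ binders of route `ResidualThetaTransportAtTwo`:

* `HabitatMuPackageAtTwo`-shaped hypothesis `hPkg` (displayed, NOT a definition): for every habitat⁺ curve `W` (non-CM,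
  `r_an = 0`, good supersingular at `2` with `a₂ = 0`, `Δ < 0`), newform `f`, `ϖ` with `ϖ Ω_W = Ω⁺_f`, Pollack pair
  `(L♯, L♭)` at `2` with the FLAT scalar `v₂(ϖ) + μ(L♭) = 0`, every cyclotomic `κ`, topological generator `γ` and finitely
  generated pinned datum `D` of `Sel⁺(W/ℚ_∞)`: a package `(I, Y, P, col, j, k, s)` — `𝐇¹_Γ(T₂W) →col P →j X⁺ →k X₀` exact at
  `P` (only the COMPLEX half `j ∘ col = 0` is asked) with `k` the PINNED restriction and COVER `ker k ≤ range j`, `s` a genuine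
  `2`-adic Euler-system class, and the μ-clause `2 ∤ col s` — the binders of S1 `FlatPlusLocalHalfAtTwo` followed by the
  WEAKEST form of those of TP2's `…_of_poitouTatePackageTwo_of_pub` (torsion dropped: it is an OUTPUT here; the prime `𝔭 ∌ 2`
  dropped: this is the `𝔭 = (2)` clause; TP2's `Function.Exact col j ∧ Function.Exact j k` imply the two clauses asked, cf.
  `isTorsion_and_mu_eq_zero_of_poitouTateMuPackageTwo` of the core file). The SAME hypothesis yields S1's text itself
  (`flatPlusLocalHalfAtTwo_of_muPackage`, file `…PlusLocalHalfOfMuPackage`, this seat). Content = (Z1) exactness + (Z2) integrality of `_{c,d}z` at `2`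
  + (Z3) μ-exact ERL⁺ at `2` (Kobayashi (7.17)–(7.21), Thm. 6.3 / Kato Thm. 12.5 at `p = 2`; research PORT, tree barrier
  `SignedIwasawaTheoryAtTwoBarrier`), nothing else.
* (F) on the habitat⁺ (`hF`, = `pt_trivial_half`'s S2 `FineResidualHabitatAtTwo` VERBATIM): `Sel₀(ℚ_∞, W[2^∞])[2]` finite at
  every cyclotomic `κ` — by class numbers per class, or by S2 + S3 of `kolyvagin_char_two` (`fineResidualFinite_of_flat`).
* analytic supply (`hS4`, = S4 `AnalyticSupplyAtTwo` VERBATIM, a THEOREM modulo modularity: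
  `SignedMuAtTwo.AnalyticSupply.analyticSupplyAtTwo_of_modularParametrization`, p644374) and FLAT = item 21437 BY NAME
  (`SignedMuAtTwo.signedMuAnalyticAtTwoPlus_iff_padicValRat_add_mu_eq_zero`; itself ⟸ Abbes–Ullmo, p643817).

## What is proved

* `signedMuSeedAtTwoPlus_of_fine_of_muPackage` — **item 21438 BY NAME** from {hPkg, hF, hS4, 21437} (`A := W`);
* `muAlgebraic_of_fine_of_muPackage` — conjunct 1 of Kμ⁺ (every f.g. `+` dual torsion with `μ = 0`) from the same;
* `signedMuVanishingAtTwoPlus_of_fine_of_muPackage` — **the crux Kμ⁺ BY NAME** from {hPkg, hF, hS4, 21437};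
* `signedMuVanishingAtTwoPlus_of_fine_of_muPackage_of_abbesUllmo` — the crux BY NAME from {hPkg, hF, hS4, Abbes–Ullmo Thm. A}.
So, for the lines of record: S1 + the split p596845 are REPLACED by the μ-package; with (F) from S2 + S3 the seed's cone is
{μ-package, S2, S3, modularity, Abbes–Ullmo}. BSD is not proved by any of this.

References: [Kobayashi2003] (7.17)–(7.21), Thm. 7.3, Thm. 6.3 (pp. 11–13); [Kato2004Asterisque] Thm. 12.5 (p. 222), §13.1 (p. 224);
[GreenbergVatsal2000] p. 3 and Prop. (2.8); [Greenberg1999LNM] Conj. 1.11; [AbbesUllmo1996] Thm. A.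
-/

set_option autoImplicit false
set_option linter.dupNamespace false

noncomputable section

open scoped Classical MatrixGroups ModularForm NumberField

open CongruenceSubgroup WeierstrassCurve Field IsDedekindDomain
  Literature.NumberTheory.GaloisRepresentations
  Literature.NumberTheory.EllipticCurves Literature.NumberTheory.EllipticCurves.ModularForms
  Literature.NumberTheory.EllipticCurves.IwasawaAlgebra Literature.NumberTheory.EllipticCurves.Rank1Residual
  Literature.NumberTheory.EllipticCurves.Kobayashi2003 Literature.NumberTheory.EllipticCurves.Kato2004 ZpExtension
  Summit.BirchSwinnertonDyer.Rank1Residual.Supersingular Summit.BirchSwinnertonDyer.Rank1Residual.X1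
  Summit.BirchSwinnertonDyer.BirchSwinnertonDyer.Theses.ResidualThetaTransportAtTwo

namespace Summit.BirchSwinnertonDyer.BirchSwinnertonDyer.Theorems.SignedMuAtTwo.PlusLocalMuRoad

/-! ## The seed, the algebraic conjunct and the crux from (F) + μ-package + supply + FLAT -/

/-- **Item 21438 `SignedMuSeedAtTwoPlus` BY NAME from {(F) on the habitat⁺, the `2`-adic Coleman–Poitou–Tate μ-package,
analytic supply, FLAT = item 21437}** (`A := W`, `e := AddEquiv.refl`): for a habitat⁺ `W` and cyclotomic `(κ, γ)` with a
finitely generated pinned datum `D`, supply gives `(f, ϖ, L♯, L♭)`, 21437 gives the FLAT scalar, `hPkg` gives the μ-package for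
`D`, and the core road `isTorsion_and_mu_eq_zero_of_muPackage` with (F) gives torsion with `μ = 0`.
[cite: Kobayashi2003, (7.17)–(7.21) and Thm. 6.3 (pp. 11–13)] [cite: GreenbergVatsal2000, p. 3 (proof of Thm. (1.4)) and Prop. (2.8)]
[cite: Greenberg1999LNM, Conj. 1.11] -/
theorem signedMuSeedAtTwoPlus_of_fine_of_muPackage
    (hPkg : ∀ (W : WeierstrassCurve ℚ) [W.IsElliptic] [W.IsGloballyMinimal], ¬ W.HasCM → W.analyticRank = 0 →
      GoodSS W 2 → W.frobeniusTrace 2 = 0 → W.Δ < 0 →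
      ∀ [NeZero (W.conductorNorm ℤ)] (f : CuspForm (Gamma0 (W.conductorNorm ℤ)) 2), IsNewformOf W f →
      ∀ (ϖ : ℚ), (ϖ : ℝ) * W.realPeriodRat = plusPeriod f →
      ∀ (Lplus Lminus : IwasawaAlgebra 2), IsPollackPair f 2 Lplus Lminus →
      padicValRat 2 ϖ + MuLambda.mu Lminus = 0 →
      ∀ [ContinuousSMul ℤ_[2] (W.tateModule 2)] [Module.Free ℤ_[2] (W.tateModule 2)]
        [Module.Finite ℤ_[2] (W.tateModule 2)]
        (κ : ZpExtension ℚ 2) (γ : Field.absoluteGaloisGroup ℚ) (hκ : κ.IsCyclotomic), κ.IsTopGenerator γ →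
      ∀ (D : SignedSelmerDualData W κ γ 1),
      ∃ (I : Kato2004.IwasawaH1Data W 2 κ γ) (Y : W.FineSelmerDualData κ γ)
        (P : Submodule (IwasawaAlgebra 2) (IwasawaAlgebra 2))
        (col : I.H →ₗ[IwasawaAlgebra 2] P) (j : P →ₗ[IwasawaAlgebra 2] D.X)
        (k : D.X →ₗ[IwasawaAlgebra 2] Y.X) (s : I.H),
        (∀ x : I.H, j (col x) = 0) ∧
        (∀ (x : D.X) (t : W.fineSelmerInfty κ),
          Y.toDual (k x) t = D.toDual x (AddSubgroup.inclusion (fineSelmerInfty_le_signedSelmerInfty W κ 1) t)) ∧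
        LinearMap.ker k ≤ LinearMap.range j ∧
        Kato2004.IsEulerSystemClassTwo W hκ I s ∧ ¬ PowerSeries.C (2 : ℤ_[2]) ∣ (P.subtype (col s)))
    (hF : ∀ (W : WeierstrassCurve ℚ) [W.IsElliptic] [W.IsGloballyMinimal], ¬ W.HasCM → W.analyticRank = 0 →
      GoodSS W 2 → W.frobeniusTrace 2 = 0 → W.Δ < 0 →
      ∀ (κ : ZpExtension ℚ 2), κ.IsCyclotomic → Set.Finite {s : W.fineSelmerInfty κ | 2 • s = 0})
    (hS4 : ∀ (W : WeierstrassCurve ℚ) [W.IsElliptic] [W.IsGloballyMinimal], GoodSS W 2 → W.frobeniusTrace 2 = 0 →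
      ∃ (_ : NeZero (W.conductorNorm ℤ)) (f : CuspForm (Gamma0 (W.conductorNorm ℤ)) 2) (ϖ : ℚ)
        (Lplus Lminus : IwasawaAlgebra 2),
        IsNewformOf W f ∧ (ϖ : ℝ) * W.realPeriodRat = plusPeriod f ∧ IsPollackPair f 2 Lplus Lminus)
    (hFlat : SignedMuAnalyticAtTwoPlus) :
    SignedMuSeedAtTwoPlus := by
  intro W _ _ hCM hr hss ha hΔ
  refine ⟨W, ‹_›, ‹_›, hss, ha, ⟨AddEquiv.refl _, fun σ P ↦ rfl⟩, fun κ γ hκ hγ D _ ↦ ?_⟩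
  obtain ⟨hN, f, ϖ, Lplus, Lminus, hf, hϖ, hP⟩ := hS4 W hss ha
  have hflat : padicValRat 2 ϖ + MuLambda.mu Lminus = 0 :=
    (signedMuAnalyticAtTwoPlus_iff_padicValRat_add_mu_eq_zero.mp hFlat) W hCM hr hss ha hΔ f hf ϖ hϖ Lplus Lminus hP
  haveI : ContinuousSMul ℤ_[2] (W.tateModule 2) := TateModule.continuousSMul_padicInt
  haveI : Module.Free ℤ_[2] (W.tateModule 2) := module_free_tateModule_holds W 2
  haveI : Module.Finite ℤ_[2] (W.tateModule 2) := module_finite_tateModule_holds W 2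
  obtain ⟨I, Y, P, col, j, k, s, hcompl, -, hcover, -, hμ⟩ :=
    hPkg W hCM hr hss ha hΔ f hf ϖ hϖ Lplus Lminus hP hflat κ γ hκ hγ D
  refine isTorsion_and_mu_eq_zero_of_muPackage hγ D Y P j k (col s).2 hμ ?_ hcover (hF W hCM hr hss ha hΔ κ hκ)
  rw [Subtype.coe_eta]
  exact hcompl s

/-- **Conjunct 1 of Kμ⁺ (algebraic μ⁺ = 0 ∧ torsion for EVERY finitely generated `+` dual of EVERY habitat⁺ curve)** from
{(F), μ-package, supply, 21437} — through the seed and the route's own `muAlgebraic_iff_signedMuSeedAtTwoPlus` (`A := W` and the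
landed propagation). [cite: GreenbergVatsal2000, p. 3 (proof of Thm. (1.4)) and Prop. (2.8)] [cite: Greenberg1999LNM, Conj. 1.11] -/
theorem muAlgebraic_of_fine_of_muPackage
    (hPkg : ∀ (W : WeierstrassCurve ℚ) [W.IsElliptic] [W.IsGloballyMinimal], ¬ W.HasCM → W.analyticRank = 0 →
      GoodSS W 2 → W.frobeniusTrace 2 = 0 → W.Δ < 0 →
      ∀ [NeZero (W.conductorNorm ℤ)] (f : CuspForm (Gamma0 (W.conductorNorm ℤ)) 2), IsNewformOf W f →
      ∀ (ϖ : ℚ), (ϖ : ℝ) * W.realPeriodRat = plusPeriod f →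
      ∀ (Lplus Lminus : IwasawaAlgebra 2), IsPollackPair f 2 Lplus Lminus →
      padicValRat 2 ϖ + MuLambda.mu Lminus = 0 →
      ∀ [ContinuousSMul ℤ_[2] (W.tateModule 2)] [Module.Free ℤ_[2] (W.tateModule 2)]
        [Module.Finite ℤ_[2] (W.tateModule 2)]
        (κ : ZpExtension ℚ 2) (γ : Field.absoluteGaloisGroup ℚ) (hκ : κ.IsCyclotomic), κ.IsTopGenerator γ →
      ∀ (D : SignedSelmerDualData W κ γ 1),
      ∃ (I : Kato2004.IwasawaH1Data W 2 κ γ) (Y : W.FineSelmerDualData κ γ)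
        (P : Submodule (IwasawaAlgebra 2) (IwasawaAlgebra 2))
        (col : I.H →ₗ[IwasawaAlgebra 2] P) (j : P →ₗ[IwasawaAlgebra 2] D.X)
        (k : D.X →ₗ[IwasawaAlgebra 2] Y.X) (s : I.H),
        (∀ x : I.H, j (col x) = 0) ∧
        (∀ (x : D.X) (t : W.fineSelmerInfty κ),
          Y.toDual (k x) t = D.toDual x (AddSubgroup.inclusion (fineSelmerInfty_le_signedSelmerInfty W κ 1) t)) ∧
        LinearMap.ker k ≤ LinearMap.range j ∧
        Kato2004.IsEulerSystemClassTwo W hκ I s ∧ ¬ PowerSeries.C (2 : ℤ_[2]) ∣ (P.subtype (col s)))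
    (hF : ∀ (W : WeierstrassCurve ℚ) [W.IsElliptic] [W.IsGloballyMinimal], ¬ W.HasCM → W.analyticRank = 0 →
      GoodSS W 2 → W.frobeniusTrace 2 = 0 → W.Δ < 0 →
      ∀ (κ : ZpExtension ℚ 2), κ.IsCyclotomic → Set.Finite {s : W.fineSelmerInfty κ | 2 • s = 0})
    (hS4 : ∀ (W : WeierstrassCurve ℚ) [W.IsElliptic] [W.IsGloballyMinimal], GoodSS W 2 → W.frobeniusTrace 2 = 0 →
      ∃ (_ : NeZero (W.conductorNorm ℤ)) (f : CuspForm (Gamma0 (W.conductorNorm ℤ)) 2) (ϖ : ℚ)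
        (Lplus Lminus : IwasawaAlgebra 2),
        IsNewformOf W f ∧ (ϖ : ℝ) * W.realPeriodRat = plusPeriod f ∧ IsPollackPair f 2 Lplus Lminus)
    (hFlat : SignedMuAnalyticAtTwoPlus) :
    ∀ (W : WeierstrassCurve ℚ) [W.IsElliptic] [W.IsGloballyMinimal], ¬ W.HasCM → W.analyticRank = 0 →
      GoodSS W 2 → W.frobeniusTrace 2 = 0 → W.Δ < 0 →
      ∀ (κ : ZpExtension ℚ 2) (γ : Field.absoluteGaloisGroup ℚ), κ.IsCyclotomic → κ.IsTopGenerator γ →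
      ∀ (D : SignedSelmerDualData W κ γ 1) [Module.Finite (IwasawaAlgebra 2) D.X],
        Module.IsTorsion (IwasawaAlgebra 2) D.X ∧ D.mu = 0 :=
  muAlgebraic_iff_signedMuSeedAtTwoPlus.mpr (signedMuSeedAtTwoPlus_of_fine_of_muPackage hPkg hF hS4 hFlat)

/-- **The crux Kμ⁺ `SignedMuVanishingAtTwoPlus` BY NAME from {(F), μ-package, analytic supply, item 21437}** (lead g3's
`signedMuVanishingAtTwoPlus_of_analytic_of_seed`: crux ⟺ 21437 ∧ 21438). No stub S1, no split. BSD is not proved by this.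
[cite: Greenberg1999LNM, Conj. 1.11] [cite: Kobayashi2003, (7.17)–(7.21) and Thm. 6.3 (pp. 11–13)] -/
theorem signedMuVanishingAtTwoPlus_of_fine_of_muPackage
    (hPkg : ∀ (W : WeierstrassCurve ℚ) [W.IsElliptic] [W.IsGloballyMinimal], ¬ W.HasCM → W.analyticRank = 0 →
      GoodSS W 2 → W.frobeniusTrace 2 = 0 → W.Δ < 0 →
      ∀ [NeZero (W.conductorNorm ℤ)] (f : CuspForm (Gamma0 (W.conductorNorm ℤ)) 2), IsNewformOf W f →
      ∀ (ϖ : ℚ), (ϖ : ℝ) * W.realPeriodRat = plusPeriod f →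
      ∀ (Lplus Lminus : IwasawaAlgebra 2), IsPollackPair f 2 Lplus Lminus →
      padicValRat 2 ϖ + MuLambda.mu Lminus = 0 →
      ∀ [ContinuousSMul ℤ_[2] (W.tateModule 2)] [Module.Free ℤ_[2] (W.tateModule 2)]
        [Module.Finite ℤ_[2] (W.tateModule 2)]
        (κ : ZpExtension ℚ 2) (γ : Field.absoluteGaloisGroup ℚ) (hκ : κ.IsCyclotomic), κ.IsTopGenerator γ →
      ∀ (D : SignedSelmerDualData W κ γ 1),
      ∃ (I : Kato2004.IwasawaH1Data W 2 κ γ) (Y : W.FineSelmerDualData κ γ)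
        (P : Submodule (IwasawaAlgebra 2) (IwasawaAlgebra 2))
        (col : I.H →ₗ[IwasawaAlgebra 2] P) (j : P →ₗ[IwasawaAlgebra 2] D.X)
        (k : D.X →ₗ[IwasawaAlgebra 2] Y.X) (s : I.H),
        (∀ x : I.H, j (col x) = 0) ∧
        (∀ (x : D.X) (t : W.fineSelmerInfty κ),
          Y.toDual (k x) t = D.toDual x (AddSubgroup.inclusion (fineSelmerInfty_le_signedSelmerInfty W κ 1) t)) ∧
        LinearMap.ker k ≤ LinearMap.range j ∧
        Kato2004.IsEulerSystemClassTwo W hκ I s ∧ ¬ PowerSeries.C (2 : ℤ_[2]) ∣ (P.subtype (col s)))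
    (hF : ∀ (W : WeierstrassCurve ℚ) [W.IsElliptic] [W.IsGloballyMinimal], ¬ W.HasCM → W.analyticRank = 0 →
      GoodSS W 2 → W.frobeniusTrace 2 = 0 → W.Δ < 0 →
      ∀ (κ : ZpExtension ℚ 2), κ.IsCyclotomic → Set.Finite {s : W.fineSelmerInfty κ | 2 • s = 0})
    (hS4 : ∀ (W : WeierstrassCurve ℚ) [W.IsElliptic] [W.IsGloballyMinimal], GoodSS W 2 → W.frobeniusTrace 2 = 0 →
      ∃ (_ : NeZero (W.conductorNorm ℤ)) (f : CuspForm (Gamma0 (W.conductorNorm ℤ)) 2) (ϖ : ℚ)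
        (Lplus Lminus : IwasawaAlgebra 2),
        IsNewformOf W f ∧ (ϖ : ℝ) * W.realPeriodRat = plusPeriod f ∧ IsPollackPair f 2 Lplus Lminus)
    (hFlat : SignedMuAnalyticAtTwoPlus) :
    SignedMuVanishingAtTwoPlus :=
  signedMuVanishingAtTwoPlus_of_analytic_of_seed hFlat (signedMuSeedAtTwoPlus_of_fine_of_muPackage hPkg hF hS4 hFlat)

/-- **The crux Kμ⁺ BY NAME from {(F), μ-package, analytic supply, Abbes–Ullmo Thm. A}** (21437 ⟸ Abbes–Ullmo alone,
`signedMuAnalyticAtTwoPlus_of_abbesUllmo'`, p643817). The line's complete cone after the node closed, with S1 + split replaced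
by the μ-package. BSD is not proved by this. [cite: AbbesUllmo1996, Thm. A] [cite: Greenberg1999LNM, Conj. 1.11] -/
theorem signedMuVanishingAtTwoPlus_of_fine_of_muPackage_of_abbesUllmo
    (hPkg : ∀ (W : WeierstrassCurve ℚ) [W.IsElliptic] [W.IsGloballyMinimal], ¬ W.HasCM → W.analyticRank = 0 →
      GoodSS W 2 → W.frobeniusTrace 2 = 0 → W.Δ < 0 →
      ∀ [NeZero (W.conductorNorm ℤ)] (f : CuspForm (Gamma0 (W.conductorNorm ℤ)) 2), IsNewformOf W f →
      ∀ (ϖ : ℚ), (ϖ : ℝ) * W.realPeriodRat = plusPeriod f →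
      ∀ (Lplus Lminus : IwasawaAlgebra 2), IsPollackPair f 2 Lplus Lminus →
      padicValRat 2 ϖ + MuLambda.mu Lminus = 0 →
      ∀ [ContinuousSMul ℤ_[2] (W.tateModule 2)] [Module.Free ℤ_[2] (W.tateModule 2)]
        [Module.Finite ℤ_[2] (W.tateModule 2)]
        (κ : ZpExtension ℚ 2) (γ : Field.absoluteGaloisGroup ℚ) (hκ : κ.IsCyclotomic), κ.IsTopGenerator γ →
      ∀ (D : SignedSelmerDualData W κ γ 1),
      ∃ (I : Kato2004.IwasawaH1Data W 2 κ γ) (Y : W.FineSelmerDualData κ γ)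
        (P : Submodule (IwasawaAlgebra 2) (IwasawaAlgebra 2))
        (col : I.H →ₗ[IwasawaAlgebra 2] P) (j : P →ₗ[IwasawaAlgebra 2] D.X)
        (k : D.X →ₗ[IwasawaAlgebra 2] Y.X) (s : I.H),
        (∀ x : I.H, j (col x) = 0) ∧
        (∀ (x : D.X) (t : W.fineSelmerInfty κ),
          Y.toDual (k x) t = D.toDual x (AddSubgroup.inclusion (fineSelmerInfty_le_signedSelmerInfty W κ 1) t)) ∧
        LinearMap.ker k ≤ LinearMap.range j ∧
        Kato2004.IsEulerSystemClassTwo W hκ I s ∧ ¬ PowerSeries.C (2 : ℤ_[2]) ∣ (P.subtype (col s)))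
    (hF : ∀ (W : WeierstrassCurve ℚ) [W.IsElliptic] [W.IsGloballyMinimal], ¬ W.HasCM → W.analyticRank = 0 →
      GoodSS W 2 → W.frobeniusTrace 2 = 0 → W.Δ < 0 →
      ∀ (κ : ZpExtension ℚ 2), κ.IsCyclotomic → Set.Finite {s : W.fineSelmerInfty κ | 2 • s = 0})
    (hS4 : ∀ (W : WeierstrassCurve ℚ) [W.IsElliptic] [W.IsGloballyMinimal], GoodSS W 2 → W.frobeniusTrace 2 = 0 →
      ∃ (_ : NeZero (W.conductorNorm ℤ)) (f : CuspForm (Gamma0 (W.conductorNorm ℤ)) 2) (ϖ : ℚ)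
        (Lplus Lminus : IwasawaAlgebra 2),
        IsNewformOf W f ∧ (ϖ : ℝ) * W.realPeriodRat = plusPeriod f ∧ IsPollackPair f 2 Lplus Lminus)
    (hAU : abbesUllmo_not_dvd_maninConstant_of_not_dvd_level) :
    SignedMuVanishingAtTwoPlus :=
  signedMuVanishingAtTwoPlus_of_fine_of_muPackage hPkg hF hS4 (signedMuAnalyticAtTwoPlus_of_abbesUllmo' hAU)

end Summit.BirchSwinnertonDyer.BirchSwinnertonDyer.Theorems.SignedMuAtTwo.PlusLocalMuRoad

end
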